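import Summits.BirchSwinnertonDyer.BirchSwinnertonDyer.Theses.CongruentShaFreeCut
import Summits.BirchSwinnertonDyer.BirchSwinnertonDyer.Theorems.CongruentShaFreeCutSquarefreeReduction
import Literature.NumberTheory.EllipticCurves.BSDSelmerCMPConverseRankOneProofs
import Literature.NumberTheory.EllipticCurves.CongruentNumberCurveConductorSign

/-! # Route `CongruentShaFreeCut` (rung S2) — crux `AnalyticRankOneOfRankOneFiniteShaTwo`
(stmt-BirchSwinnertonDyer-19080) lives on the square-free classes `n ≡ 5, 6, 7 (mod 8)`

WHERE crux B = `rank E_n(ℚ) = 1 ∧ #Ш(E_n/ℚ)[2^∞] < ∞ ⟹ ord_{s=1} L(E_n, s) = 1` (every `n ≠ 0`) has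
content, kernel-checked: granted the `2`-parity theorem (`p_parity`, Dokchitser–Dokchitser 2010 Thm.
1.4 / Monsky 1996; the only named fact used), it suffices to prove it for SQUARE-FREE `n ≡ 5, 6, 7
(mod 8)` — Smith's density-one classes, Tian's families, the root-number-`−1` half of the twist
family. Proof: reduce to square-free `n` (tree theorem
`CongruentShaFreeCutSquarefreeReduction.analyticRankOneOfRankOneFiniteShaTwo_of_squarefree`); then
`rank = 1 ∧ #Ш[2^∞] < ∞` gives `corank_{ℤ₂} Sel_{2^∞}(E_n) = 1` (Greenberg, tree theorem
`selmerCorank_eq_one_of_mordellWeilRank_eq_one_of_finite`), so `w(E_n) = −1` by `2`-parity, while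
`w(E_n) = +1` UNCONDITIONALLY for square-free `n ≡ 1, 2, 3 (mod 8)` (tree theorem
`rootNumber_congruentNumberCurve_eq_one_of_mod_eight`, Koblitz GTM 97 Ch. II §5) and a square-free
`n` is `≢ 0, 4 (mod 8)`. (The converse bookkeeping is trivial: the restricted statement is a
specialisation.) Supports, does not close, stmt-BirchSwinnertonDyer-19080. -/

namespace Summit.BirchSwinnertonDyer.BirchSwinnertonDyer.Theorems.CongruentShaFreeCutResidueClasses

open Literature.NumberTheory.EllipticCurves WeierstrassCurve
open Summit.BirchSwinnertonDyer.BirchSwinnertonDyer.Theses.CongruentShaFreeCut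

/-- **The hypotheses of crux B force `n ≡ 5, 6, 7 (mod 8)`** (square-free `n`), granted
`2`-parity (`hpar`): `rank E_n(ℚ) = 1 ∧ #Ш(E_n/ℚ)[2^∞] < ∞ ⟹ corank_{ℤ₂} Sel_{2^∞}(E_n) = 1 ⟹
w(E_n) = −1`, and `w(E_n) = +1` for square-free `n ≡ 1, 2, 3 (mod 8)` (Koblitz), `n ≢ 0, 4 (mod 8)`.
[cite: KoblitzECMF1993, Ch. II §5, Theorem (p. 84)] [cite: DokchitserDokchitserAnnals2010, Thm. 1.4] -/
theorem mod_eight_of_rank_eq_one_of_finite_sha_two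
    (hpar : ∀ (W : WeierstrassCurve ℚ) [W.IsElliptic] (p : ℕ) [Fact p.Prime], p_parity W p)
    {n : ℕ} (hsq : Squarefree n) (hrank : (congruentNumberCurve n).mordellWeilRank = 1)
    (hsha : Finite (AddCommGroup.primaryComponent (congruentNumberCurve n).sha 2)) :
    n % 8 = 5 ∨ n % 8 = 6 ∨ n % 8 = 7 := by
  haveI := isElliptic_congruentNumberCurve hsq.ne_zero
  haveI : Fact (Nat.Prime 2) := ⟨Nat.prime_two⟩
  have hcorank : (congruentNumberCurve n).selmerCorank 2 = 1 :=
    selmerCorank_eq_one_of_mordellWeilRank_eq_one_of_finite _ 2 hrank hsha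
  have hw : (congruentNumberCurve n).rootNumber = -1 := by
    have h := hpar (congruentNumberCurve n) 2
    unfold p_parity at h
    rw [hcorank, pow_one] at h
    exact h.symm
  by_contra h567
  have h4 : ¬ 4 ∣ n := fun h ↦ absurd (Nat.isUnit_iff.mp (hsq 2 h)) (by norm_num)
  have h123 : n % 8 = 1 ∨ n % 8 = 2 ∨ n % 8 = 3 := by omega
  have h1 := rootNumber_congruentNumberCurve_eq_one_of_mod_eight hsq h123
  rw [h1] at hw
  norm_num at hw

/-- **Crux B reduces to the square-free classes `n ≡ 5, 6, 7 (mod 8)`**, granted `2`-parity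
(`hpar`): if `rank E_n(ℚ) = 1 ∧ #Ш(E_n/ℚ)[2^∞] < ∞ ⟹ ord_{s=1} L(E_n, s) = 1` holds for every
square-free `n ≡ 5, 6, 7 (mod 8)`, it holds for every `n ≠ 0` (square-free reduction
`analyticRankOneOfRankOneFiniteShaTwo_of_squarefree` + `mod_eight_of_rank_eq_one_of_finite_sha_two`).
[cite: DokchitserDokchitserAnnals2010, Thm. 1.4] -/
theorem analyticRankOneOfRankOneFiniteShaTwo_of_mod_eight
    (hpar : ∀ (W : WeierstrassCurve ℚ) [W.IsElliptic] (p : ℕ) [Fact p.Prime], p_parity W p)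
    (h : ∀ ⦃n : ℕ⦄, Squarefree n → (n % 8 = 5 ∨ n % 8 = 6 ∨ n % 8 = 7) →
      (congruentNumberCurve n).mordellWeilRank = 1 →
        Finite (AddCommGroup.primaryComponent (congruentNumberCurve n).sha 2) →
          (congruentNumberCurve n).analyticRank = 1) :
    AnalyticRankOneOfRankOneFiniteShaTwo :=
  CongruentShaFreeCutSquarefreeReduction.analyticRankOneOfRankOneFiniteShaTwo_of_squarefree
    fun _ hsq hrank hsha =>
      h hsq (mod_eight_of_rank_eq_one_of_finite_sha_two hpar hsq hrank hsha) hrank hsha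

end Summit.BirchSwinnertonDyer.BirchSwinnertonDyer.Theorems.CongruentShaFreeCutResidueClasses
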